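import Summits.Ventures.HSemireg.SemiregularityTheorems
import Literature.AlgebraicGeometry.HodgeTheory.BlochSemiregularSpreadOfSubschemeGlobal
import HarnessLib

/-!
# Venture HSemireg — Bloch 1972, Thm. (7.4) and Remark (7.5) AT THEIR PRINTED SCOPE (an ARBITRARY local
# complete intersection `Z₀`, class `z₀ = [Z₀]`), indexed in the venture namespace; part 2 of
# `SemiregularityTheorems.lean` (theory seat th-1 of the cell `pub-hsemireg`)

HONEST FRAMING. Companion/continuation of `SemiregularityTheorems.lean` (same seat, same rules): an INDEX file of
a computation cell. It makes NO claim about any explicit variety and proves NO case of the Hodge conjecture; it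
contains NO `def … : Prop`; every declaration is a kernel-checked `theorem` whose hypotheses NAME the tree's
refereed facts it rests on (`BlochSemiregularSpreadOfSubscheme n p`, `charlesSchnell_algebraicityLocus_iUnion_closed`),
so nothing is vendored, relocated or minted (net debt 0) and a consumer's trust base is literally those facts.

WHY A PART 2. `SemiregularityTheorems.lean` renders Bloch (7.4)/(7.5) (`Bloch1972.theorem74`,
`Bloch1972.semiregular_deforms`) for an INTEGRAL `Z₀` only — its Scope (R2) records reducible / non-reduced
local complete intersections as "NOT covered — in progress, seat lit-1", because when it was written the tree's
only class-level Bloch fact (`BlochSemiregularSpread n p`) asks `Z` integral. Bloch's printed (7.4) allows ANY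
"subscheme of codimension `p` which is a local complete intersection" (§0, p. 51) with `z₀ = [Z₀]` "the
topological cycle class" ((7.1), p. 64), and so does Buchweitz–Flenner's Thm. 5.2 (`α_p(0) = ch_p(𝒪_{Z₀})`). The
tree has since landed exactly this: the named fact `BlochSemiregularSpreadOfSubscheme n p`
(`Literature/AlgebraicGeometry/HodgeTheory/BlochSemiregularSpreadOfSubscheme.lean`; class hypothesis
`x = subschemeClass …` = Fulton's cycle `Σᵢ ℓ(𝒪_{Z,Zᵢ})·[Zᵢ]` of the subscheme read through the tree's cycle
class of a resolution family, complex orientations), its global companions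
(`BlochSemiregularSpreadOfSubschemeGlobal.lean`, Bloch's last paragraph of the proof of (7.4)), and the cell's
component-form door `hc_on_component_of_semiregular_subscheme{,_of_smul_add}` (`ComponentTransferSubscheme.lean`,
seat th-3). This file indexes (7.4) and (7.5) in Bloch's binder order AT THEIR PRINTED SCOPE — reducible and
non-reduced local complete intersections included; the cell's STEP-0 class (A) representative, Schoen's
`Δ_J ∪ (C × C) ⊂ J(C)²`, is reducible — so that Scope (R2) of part 1 is COVERED at the index level. The file is
kept separate only for the tree's size rule (index files ≤ 400 lines).

## Source (page/line of the PRINTED pages; verbatim in the theorem docstrings; typed file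
## `run/shared/lean/pub/pub-hsemireg/lit/Bloch1972.md`, page images `…/lit/Bloch1972-Invent17-GDZ/`)

S. Bloch, *Semi-regularity and de Rham cohomology*, Invent. Math. 17 (1972) 51–66: §0 p. 51 lines 1–4 ("Let
`Z ⊂ X` be a subscheme of codimension `p` which is a local complete intersection"); (7.1) p. 64 lines 17–22
("Suppose that the topological cycle class `[Z₀] ∈ H^{2p}` lifts to a horizontal class `z` … Then `Z₀` lifts to a
subscheme `Z ⊂ X`"); (7.4) p. 65 lines 9–14 and the last paragraph of its proof ("`T = S`"); (7.5) p. 65 lines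
29–35. R.-O. Buchweitz, H. Flenner, Compositio Math. 137 (2003): Thm. 5.2 p. 175 lines 13–17; proof of Cor. 4.12
p. 172 (`[Z] = ch_k(𝒪_Z)`); (8.1)–Prop. 8.2 pp. 199–200 (`τ_B = τ`: Bloch-semiregular = `{p}`-semiregular for an
lci of codimension `p`).

## Rendering clauses that are not printed binders (all inherited from the fact; see its module docstring)

`hX₀ : IsSmoothProjective n X₀` (to read the cycle class on the abstract model `X₀ ≅ 𝒳_{s₀}` of the fibre); the
dimension `d` with `d + p = n` and a resolution family `ρ` through which `[Z₀]` is read (any `ρ`);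
`hmem : [Z₀] ∈ Z_d(X₀)` (automatic for an lci of codimension `p`; kept as a clause exactly as in the fact);
`[IsLocallyNoetherian Z]` (to form Fulton's cycle). As in part 1: "`g` smooth, connected, of finite type" =
`S` smooth IRREDUCIBLE quasi-projective; "`z` horizontal" = a global class `W` with fibre restrictions rational
of type `(p,p)`; "for all `s`" = every `t ∈ S(ℂ)`.

## What is proved here (trust base = the named facts taken as hypotheses, all pre-existing in the tree)

* `Bloch1972.theorem74_lci (hBS : BlochSemiregularSpreadOfSubscheme n p) (hCS : charlesSchnell_algebraicityLocus_iUnion_closed) …`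
  — (7.4) global, any lci `Z₀`, `z₀ = [Z₀]` (lit-1's `BlochSemiregularSpreadOfSubscheme.forall_mem_algebraicClasses`
  in Bloch's binder order).
* `Bloch1972.semiregular_deforms_lci (hBS) (hCS) …` — (7.4) + (7.5) global, any lci `Z₀`: `a•W + A` with
  `a ∈ ℤ ∖ {0}` and `A` fibrewise rational algebraic (printed instance `A = b·lᵖ`), proved FROM `theorem74_lci` by
  the printed one-line argument. Companion statements in the tree: lit-1's `…_of_smul_add` (`a b : ℤ`),
  `…_of_rat_smul_add` (`a b : ℚ`); th-3's component forms.

## References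

* [Bloch1972Semiregularity] S. Bloch, Invent. Math. 17 (1972) 51–66: §0 p. 51, (7.1) p. 64, (7.4)–(7.5) p. 65.
* [BuchweitzFlenner2003] R.-O. Buchweitz, H. Flenner, Compositio Math. 137 (2003) 135–210: Thm. 5.2 p. 175,
  Cor. 4.12 p. 172, (8.1)–Prop. 8.2 pp. 199–200.
* [Fulton1998] W. Fulton, *Intersection Theory*, §1.5 (`[Z] = Σ mᵢ[Zᵢ]`), §19.1.
* [CharlesSchnell2014Notes] F. Charles, C. Schnell, Notes on absolute Hodge classes, proof of Prop. 11.3.11.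
-/

noncomputable section

open CategoryTheory AlgebraicGeometry Set
open Literature.AlgebraicGeometry.HodgeTheory Literature.AlgebraicGeometry.Motives
open Literature.AlgebraicTopology.SingularHomology

namespace Summit.Ventures.HSemireg

local notation3 (prettyPrint := false) "Res[" f ", " s ", " k ", " A "]" =>
  complexBetti.map (Literature.AlgebraicGeometry.Motives.fiberι f s) k A

/-! ## Bloch 1972, (7.4) and (7.5): arbitrary local complete intersection `Z₀`, `z₀ = [Z₀]` -/

namespace Bloch1972

variable {n p : ℕ}

/-- **Bloch 1972, Thm. (7.4) (p. 65, lines 9–14) AT ITS PRINTED SCOPE — `Z₀` ANY local complete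
intersection subscheme of codimension `p`, `z₀ = [Z₀]` its topological cycle class — class level, GLOBAL
over the connected base; a theorem modulo the tree's named facts `BlochSemiregularSpreadOfSubscheme n p`
and `charlesSchnell_algebraicityLocus_iUnion_closed`.** Printed: "Let `X →ᶠ S →ᵍ Spec(ℂ)` be morphisms,
with `f` smooth and projective and `g` smooth, connected, and of finite type. Let
`z ∈ Γ(S, R^{2p} f_*(Ω•_{X/S}))` be a horizontal section and let `o ∈ S`. Suppose the restricted class
`z₀ ∈ H^{2p}_{DR}(X₀/ℂ)` is algebraic, representing a local complete intersection, `Z₀ ⊂ X₀` which is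
semi-regular in `X₀`. Then for all `s ∈ S`, `z_s ∈ H^{2p}_{DR}(X_s/ℂ)` is algebraic." By the printed
proof ("`z̄`, `Z₀`, `X̄` satisfy the hypotheses of (7.1)") and (7.1) (p. 64, lines 17–22: "Suppose that
the topological cycle class `[Z₀] ∈ H^{2p}` lifts to a horizontal class `z`"), "`z₀` algebraic,
representing `Z₀`" means `z₀ = [Z₀]`, the cycle class of the SUBSCHEME `Z₀`, and `Z₀` is any "subscheme
of codimension `p` which is a local complete intersection" (§0, p. 51, lines 1–4) — no integrality, no
reducedness. RENDERING: the binders of `theorem74` with `hZ : IsIntegral Z` DROPPED and the class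
hypothesis replaced by the printed one, `e^*(W|_{𝒳_{s₀}}) = [Z]` with
`[Z] = subschemeClass hX₀ hdp ρ i hi` (Fulton's `Σᵢ mᵢ cl(Zᵢ)`, `mᵢ = ℓ(𝒪_{Z,Zᵢ})`, read in dimension
`d = n - p` under the tree's cycle class through a resolution family `ρ` for the complex orientations;
Buchweitz–Flenner: `[Z] = ch_p(𝒪_Z)`, proof of Cor. 4.12), together with the clause `[Z] ∈ Z_d(X₀)`
(`hmem`) and `hX₀ : IsSmoothProjective n X₀`. Everything else is verbatim the rendering of `theorem74`
(dictionary in its docstring): `S` smooth irreducible quasi-projective, `W` a global class fibrewise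
rational of type `(p,p)` (the horizontal section `z`), `i : Z ↪ X₀ ≅ 𝒳_{s₀}` a Bloch-semiregular regular
immersion of codimension `p`, conclusion `W|_{𝒳_t} ∈ algebraicClasses (𝒳_t) p` for EVERY `t ∈ S(ℂ)`.
Proof = Bloch's, as for `theorem74`: the local fact gives an open `U ∋ s₀` of algebraicity and the last
paragraph of the printed proof ("`T = {s ∈ S | z_s is algebraic}` is contained in a countable union of
closed subvarieties of `S`. Since `U ⊂ T`, it follows that `T = S`") spreads it — this is lit-1's
`BlochSemiregularSpreadOfSubscheme.forall_mem_algebraicClasses` in Bloch's binder order. Trust base: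
exactly `hBS`, `hCS`.
[cite: Bloch1972Semiregularity, Thm. (7.4) p. 65 (lines 9–14) with Thm. (7.1) p. 64 (lines 17–22) and §0 p. 51; last paragraph of the proof of (7.4), p. 65]
[cite: BuchweitzFlenner2003, Thm. 5.2 p. 175 (local form); proof of Cor. 4.12 p. 172 ([Z] = ch_p(𝒪_Z)); (8.1)–Prop. 8.2 pp. 199–200]
[cite: Fulton1998, §1.5 ([Z] = Σ mᵢ[Zᵢ])]
[cite: CharlesSchnell2014Notes, Prop. 11.3.11 (proof)] -/
theorem theorem74_lci (hBS : BlochSemiregularSpreadOfSubscheme n p)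
    (hCS : charlesSchnell_algebraicityLocus_iUnion_closed)
    -- "`f` smooth and projective", "`g` smooth, connected, and of finite type"
    {𝒳 S : SchemeOver ℂ} (f : 𝒳 ⟶ S) (hf : IsSmoothProjectiveFamily f n) (h𝒳 : IsQuasiProjectiveOver 𝒳)
    (hS : IsQuasiProjectiveOver S) (hSm : AlgebraicGeometry.Smooth S.hom) [IrreducibleSpace S.left]
    -- "`z` a horizontal section", a rational class of Hodge type `(p,p)` on every fibre
    (W : complexBetti 𝒳 (2 * p))
    (hW : ∀ s : ComplexPoints S, IsRationalClass (Res[f, s, 2 * p, W]) ∧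
      IsOfHodgeType n (fiberOver f s) (2 * p) p p (Res[f, s, 2 * p, W]))
    -- "let `o ∈ S`", the fibre `X₀` (a smooth projective `n`-fold, read on an abstract model)
    (s₀ : ComplexPoints S) (X₀ : SchemeOver ℂ) (e : X₀ ≅ fiberOver f s₀) (hX₀ : IsSmoothProjective n X₀)
    -- "a local complete intersection `Z₀ ⊂ X₀`" of codimension `p` — ANY closed lci subscheme
    (Z : Scheme.{0}) (i : Z ⟶ X₀.left) [IsLocallyNoetherian Z] (hi : IsClosedImmersion i)
    (hreg : IsRegularImmersionOfCodim i p) (hcodim : ∀ z ∈ Set.range i.base, (p : ℕ∞) ≤ Order.coheight z)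
    -- "which is semi-regular in `X₀`"
    (hsr : IsBlochSemiregular i n p)
    -- "`z₀` is algebraic, representing `Z₀`": `z₀ = [Z₀]`, the cycle class of the subscheme, read in
    -- dimension `d = n - p` through a resolution family `ρ`
    (d : ℕ) (hdp : d + p = n) (ρ : ResolutionFamily X₀ d)
    (hmem : subschemeCycle i hi ∈ cyclesOfDim X₀.left d)
    (hWZ : complexBetti.map e.hom (2 * p) (Res[f, s₀, 2 * p, W]) = subschemeClass hX₀ hdp ρ i hi)
    -- "Then for all `s ∈ S`, `z_s` is algebraic."
    (t : ComplexPoints S) : Res[f, t, 2 * p, W] ∈ algebraicClasses (fiberOver f t) p :=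
  hBS.forall_mem_algebraicClasses hCS X₀ Z i (subschemeClass hX₀ hdp ρ i hi) f s₀ e W hX₀ d hdp ρ hi
    hreg hcodim hsr hmem rfl hf h𝒳 hS hSm hW hWZ t

/-- **Bloch 1972, Thm. (7.4) with the weakening of Remark (7.5) (p. 65, lines 29–35) AT ITS PRINTED
SCOPE — "there exist integers `a, b`, `a ≠ 0`, such that `a z₀ + b l₀ᵖ` is the class of a subscheme
`Z₀ ⊂ X₀` which is semi-regular and a local complete intersection", `Z₀` ANY lci subscheme — a theorem
modulo the same two named facts.** RENDERING: as `theorem74_lci`, with the class hypothesis replaced by: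
an integer `a ≠ 0` and a global class `A ∈ H^{2p}(𝒳(ℂ); ℂ)` whose fibre restrictions are RATIONAL and
ALGEBRAIC on every fibre (the printed instance is `A = b·lᵖ`, `l` the polarization class) such that
`e^*((a•W + A)|_{𝒳_{s₀}}) = [Z₀]` (`subschemeClass`); conclusion: `W|_{𝒳_t}` is algebraic for EVERY
`t ∈ S(ℂ)`. Proof, as printed and as for `semiregular_deforms`: apply (7.4) (`theorem74_lci`) to the
horizontal class `a z + A` — a rational Hodge class on every fibre, whose value at `s₀` is `[Z₀]` — then
subtract the algebraic class `A_s` and divide by `a ≠ 0` in the `ℂ`-subspace of algebraic classes. This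
is the shape the cell's transfer chain consumes for a REDUCIBLE representative (class (A): the class of
Schoen's `Δ_J ∪ (C × C)` is `a·w + b·θ²`-type). Companion statements in the tree: lit-1's
`BlochSemiregularSpreadOfSubscheme.forall_mem_algebraicClasses_of_smul_add` (`A = b·L`, `a b : ℤ`) and
`…_of_rat_smul_add` (`a b : ℚ`); th-3's `hc_on_component_of_semiregular_subscheme_of_smul_add`
(component form). Trust base: `hBS`, `hCS`.
[cite: Bloch1972Semiregularity, Remark (7.5) and Thm. (7.4), p. 65]
[cite: BuchweitzFlenner2003, Thm. 5.2 p. 175; proof of Cor. 4.12 p. 172]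
[cite: CharlesSchnell2014Notes, Prop. 11.3.11 (proof)] -/
theorem semiregular_deforms_lci (hBS : BlochSemiregularSpreadOfSubscheme n p)
    (hCS : charlesSchnell_algebraicityLocus_iUnion_closed)
    {𝒳 S : SchemeOver ℂ} (f : 𝒳 ⟶ S) (hf : IsSmoothProjectiveFamily f n) (h𝒳 : IsQuasiProjectiveOver 𝒳)
    (hS : IsQuasiProjectiveOver S) (hSm : AlgebraicGeometry.Smooth S.hom) [IrreducibleSpace S.left]
    -- `z`: horizontal, a rational Hodge class on every fibre
    (W : complexBetti 𝒳 (2 * p))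
    (hW : ∀ s : ComplexPoints S, IsRationalClass (Res[f, s, 2 * p, W]) ∧
      IsOfHodgeType n (fiberOver f s) (2 * p) p p (Res[f, s, 2 * p, W]))
    -- `b·lᵖ`: a global class, rational and algebraic on every fibre
    (A : complexBetti 𝒳 (2 * p))
    (hA : ∀ s : ComplexPoints S, IsRationalClass (Res[f, s, 2 * p, A]) ∧
      Res[f, s, 2 * p, A] ∈ algebraicClasses (fiberOver f s) p)
    (a : ℤ) (ha : a ≠ 0)
    (s₀ : ComplexPoints S) (X₀ : SchemeOver ℂ) (e : X₀ ≅ fiberOver f s₀) (hX₀ : IsSmoothProjective n X₀)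
    (Z : Scheme.{0}) (i : Z ⟶ X₀.left) [IsLocallyNoetherian Z] (hi : IsClosedImmersion i)
    (hreg : IsRegularImmersionOfCodim i p) (hcodim : ∀ z ∈ Set.range i.base, (p : ℕ∞) ≤ Order.coheight z)
    (hsr : IsBlochSemiregular i n p)
    (d : ℕ) (hdp : d + p = n) (ρ : ResolutionFamily X₀ d)
    (hmem : subschemeCycle i hi ∈ cyclesOfDim X₀.left d)
    -- "`a z₀ + b l₀ᵖ` is the class of" the semiregular local complete intersection `Z₀`: `= [Z₀]`
    (hWAZ : complexBetti.map e.hom (2 * p) (Res[f, s₀, 2 * p, (a : ℂ) • W + A]) =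
      subschemeClass hX₀ hdp ρ i hi)
    (t : ComplexPoints S) : Res[f, t, 2 * p, W] ∈ algebraicClasses (fiberOver f t) p := by
  -- fibre restrictions of `W' := a•W + A`
  have hres : ∀ s : ComplexPoints S,
      Res[f, s, 2 * p, (a : ℂ) • W + A] = (a : ℂ) • Res[f, s, 2 * p, W] + Res[f, s, 2 * p, A] := by
    intro s
    rw [map_add, map_smul]
  -- `W'` is fibrewise rational of type `(p,p)` (algebraic classes are of type `(p,p)`)
  have hW'H : ∀ s : ComplexPoints S, IsRationalClass (Res[f, s, 2 * p, (a : ℂ) • W + A]) ∧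
      IsOfHodgeType n (fiberOver f s) (2 * p) p p (Res[f, s, 2 * p, (a : ℂ) • W + A]) := by
    intro s
    rw [hres]
    have hrat : IsRationalClass ((a : ℂ) • Res[f, s, 2 * p, W]) := by
      have h := (hW s).1.smul (a : ℚ)
      rwa [Rat.cast_intCast] at h
    exact ⟨hrat.add (hA s).1,
      ((hW s).2.smul (a : ℂ)).add (hf.isSmoothProjective s)
        (isOfHodgeType_of_mem_algebraicClasses_of_isSmoothProjective (hf.isSmoothProjective s) p
          (hA s).2)⟩
  -- (7.4) at printed scope for `W'`: algebraic on every fibre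
  have halg := theorem74_lci hBS hCS f hf h𝒳 hS hSm ((a : ℂ) • W + A) hW'H s₀ X₀ e hX₀ Z i hi hreg
    hcodim hsr d hdp ρ hmem hWAZ t
  rw [hres] at halg
  -- subtract `A|_{𝒳_t}` and divide by `a`
  have ha' : (a : ℂ) ≠ 0 := Int.cast_ne_zero.mpr ha
  have hsmul : (a : ℂ) • Res[f, t, 2 * p, W] ∈ algebraicClasses (fiberOver f t) p := by
    have h := Submodule.sub_mem _ halg (hA t).2
    rwa [add_sub_cancel_right] at h
  have h := Submodule.smul_mem _ (a : ℂ)⁻¹ hsmul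
  rwa [smul_smul, inv_mul_cancel₀ ha', one_smul] at h

end Bloch1972

end Summit.Ventures.HSemireg

end
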